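import Mathlib
import Literature.NumberTheory.LFunctions.Zhang2022.Section11LamCSums
import Literature.NumberTheory.LFunctions.Zhang2022.SkeletonPartTwo
import Literature.NumberTheory.LFunctions.ExceptionalPrimesAbel
import Literature.NumberTheory.Sieve.ShiuDivisorClass
import HarnessLib

/-!
# Zhang (2022) §11 p. 64: the arithmetic sum `S_j(𝐛, 𝐛̄)` of Proposition 7.1 for a SINGLE-WINDOW
# sequence — an elementary bound from the periodicity of `χ`

Topic `Literature/NumberTheory/LFunctions/Zhang2022` (Landau–Siegel audit tree; verdict-neutral).
Y. Zhang, *Discrete mean estimates and the Landau–Siegel zero*, arXiv:2211.02515v1 (2022)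
[Zhang2022LandauSiegel], §7 p. 33 (Proposition 7.1: the main term `α⁻¹(½S₁+2S₂+3/2S₃)𝔓` and the
error `E(𝐚₁,𝐚₂) = 𝔓𝓛²Σ|S_j|` of the mean value `Θ₁(𝐚₁,𝐚₂)`, with
`S_j(𝐚₁,𝐚₂) = Σ_dΣ_r |μ(r)|λ₀ⱼ(dr)/(drφ(r))·(Σ_m a₁(drm)m^{−(1−β_j)})(Σ_n a₂(drn)ξ₀ⱼ(n;d,r)/n)`) and
§11 p. 64, tex L3299 («By (11.3), (8.25) and (8.26), ΣΣ𝔠*|Σ_{n∈𝔍₁}χψ(n)n^{−ρ}(f̃ − g̃₁)(n)|²ω =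
o(𝔞𝔓)»; DAG nodes `Z22:§11.u019`, `Z22:§11.u021`; GAP row G-L3t10-1: the displays (8.25)/(8.26) do
not exist in v1) — **an unrefereed manuscript under adjudication; nothing in this file asserts or
denies its Theorems 1–2.** THEOREMS ONLY (no definition, no new claim).

The leaves `Typed.TypedSection11B.Step11u019 c′` / `Step11u019J2 c′` are reduced in the tree
(`Section11WindowMeanSquare`, `Section8DiscreteMeanSquare`) to the smallness
`𝓛⁹·S_j(𝐚, 𝐚̄) → 0` for the window sequences of (11.5). This file supplies the ARITHMETIC bound for
a sequence living on ONE window: for `b(n) = χ(n)w(n)` with `w` supported on the integers of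
`(Xη₋, Xη₊)` (`η_± = e^{±𝓛⁻¹⁰}`, `Xη₊ ≤ ⌈PT⁻²⌉`), `|w| ≤ δ`, `|w(n') − w(n)| ≤ Λ log(n'/n)` there,
and `χ ≠ 1` mod `D`:

* `norm_Sj_window_le` — **`‖S_j(𝐛, 𝐛̄)‖ ≤ K·δ(δ + Λ)·𝓛⁹`** for `D ≥ D₀(c′)`, all `j`, with `K`
  absolute. For the three windows of `𝔍₁` (resp. `𝔍₂`) one has `δ, Λ = O(𝓛⁻¹⁰)` (Lemma 11.1 (11.3)
  and the slow variation of `f̃(log y/log P) − g̃₁(y)`), so `𝓛⁹‖S_j‖ = O(𝓛⁻²) → 0` window by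
  window, and `|Σ_a W_a|² ≤ 3Σ_a|W_a|²` assembles the leaves.

Why a single window, and why no short-interval divisor-sum input is needed: the `m`-sum and the
`n`-sum of `S_j` for `k = dr` both run over the SAME integers of `(Xη₋/k, Xη₊/k)`. Per `k`
(`msum_mul_nsum_le`): (A) if `Xη₋/k ≥ D²` the window is long, and the `m`-sum
`Σ_m χ(km)w(km)m^{−(1−β_j)} = χ(k)Σ_m χ(m)·(w(km)m^{−(1−β_j)})` is `≤ 20(δ+Λ)/D` by Abel summation
against the window sums `|Σχ| ≤ 2D` of the non-principal `χ` (tree: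
`SiegelZero.sum_Ioc_mul_eq_abel`, `norm_sum_Ioc_apply_le`; `norm_sum_window_twist_le`), while the
`n`-sum is `≤ δE(log N)⁵` by the tree's `T`-free majorant (`sum_norm_xiZero_div_le`); (B1) if the
window is short but of length `≥ 1`, its harmonic sum is `≤ 2(η₊/η₋ − 1) ≤ 8𝓛⁻¹⁰` and the `n`-sum is
`≤ δE(log 2D²)⁵`; (B2) if its length is `< 1` both sums have at most one term `n₀` and
`|ξ₀ⱼ(n₀;d,r)| ≤ gC(n₀) ≤ An₀` (divisor class, `Sieve.ShiuDivisorClass.exists_rpow_majorant`).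
The weights are summed with the tree's `sum_LamC_div_le` (`≪ log N ≤ 2𝓛⁹`) and
`sum_moebius_LamC_div_le` (`≪ 1`). (Cross terms between DIFFERENT windows — a short `m`-window
against a long `n`-window — are exactly what this per-window organisation avoids.)

No statement about the manuscript's Theorems 1–2 or about Landau–Siegel zeros is made or implied.

## References

* Y. Zhang, arXiv:2211.02515v1 (2022), §7 Prop. 7.1 p. 33; §11 p. 64 (tex L3299, L3306).
  [cite: Zhang2022LandauSiegel, §7 Prop. 7.1 p.33; §11 p.64]
* H. L. Montgomery, R. C. Vaughan, *Multiplicative Number Theory I*, CUP 2007, §1.3 Thm 1.3 (Abel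
  summation), §4.3 (4.23). [cite: MontgomeryVaughan2007, §1.3 Thm 1.3]
-/

noncomputable section

open Finset
open scoped ComplexConjugate

namespace Literature.NumberTheory.LFunctions.Zhang2022.SjWindow

open Literature.NumberTheory.LFunctions.Zhang2022.XiZeroMajorant
open Literature.NumberTheory.LFunctions.Zhang2022.Skeleton

/-! ### Part 1. Elementary lemmas -/

/-- `(log x)^n ≤ nⁿ·x` for `x ≥ 1`, `n ≥ 1` (`log x = n log x^{1/n} ≤ n x^{1/n}`). [folklore] -/
private theorem pow_log_le {x : ℝ} (hx : 1 ≤ x) {n : ℕ} (hn : 1 ≤ n) :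
    Real.log x ^ n ≤ (n : ℝ) ^ n * x := by
  have hx0 : 0 < x := by linarith
  have hn0 : (0 : ℝ) < n := by exact_mod_cast hn
  set y : ℝ := x ^ (1 / (n : ℝ)) with hy
  have hy0 : 0 < y := Real.rpow_pos_of_pos hx0 _
  have hy1 : 1 ≤ y := Real.one_le_rpow hx (by positivity)
  have hlog : Real.log x = n * Real.log y := by
    rw [hy, Real.log_rpow hx0]; field_simp
  have hlogy : Real.log y ≤ y := by linarith [Real.log_le_sub_one_of_pos hy0]
  have hlog0 : 0 ≤ Real.log x := Real.log_nonneg hx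
  have h1 : Real.log x ≤ n * y := by
    rw [hlog]; exact mul_le_mul_of_nonneg_left hlogy hn0.le
  have hyn : y ^ n = x := by
    rw [hy, ← Real.rpow_natCast, ← Real.rpow_mul hx0.le, one_div_mul_cancel hn0.ne', Real.rpow_one]
  calc Real.log x ^ n ≤ ((n : ℝ) * y) ^ n := pow_le_pow_left₀ hlog0 h1 n
    _ = (n : ℝ) ^ n * x := by rw [mul_pow, hyn]

/-- `Σ_{A < m ≤ B} 1/m² ≤ 1/A` for `A ≥ 1` (telescoping `1/m² ≤ 1/(m−1) − 1/m`). [folklore] -/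
private theorem sum_Ioc_inv_sq_le {A B : ℕ} (hA : 1 ≤ A) :
    ∑ m ∈ Ioc A B, (1 : ℝ) / (m : ℝ) ^ 2 ≤ 1 / A := by
  rcases le_or_gt A B with hAB | hAB
  · have key : ∑ m ∈ Ioc A B, (1 : ℝ) / (m : ℝ) ^ 2 ≤ 1 / A - 1 / B := by
      induction B, hAB using Nat.le_induction with
      | base => simp
      | succ B hB ih =>
        rw [Finset.sum_Ioc_succ_top hB]
        have hB0 : (0 : ℝ) < B := by exact_mod_cast (by omega : 0 < B)
        have hstep : (1 : ℝ) / ((B + 1 : ℕ) : ℝ) ^ 2 ≤ 1 / B - 1 / ((B + 1 : ℕ) : ℝ) := by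
          push_cast
          rw [div_sub_div _ _ hB0.ne' (by positivity), div_le_div_iff₀ (by positivity) (by positivity)]
          nlinarith
        linarith
    have hB0 : (0 : ℝ) ≤ 1 / B := by positivity
    linarith
  · rw [Finset.Ioc_eq_empty (by omega), Finset.sum_empty]; positivity

/-- `‖m^{−s} − (m+1)^{−s}‖ ≤ 4/m²` for `m ≥ 2`, `Re s = 1`, `|s| ≤ 2`
(`(m+1)^{−s} = m^{−s}(1+1/m)^{−s}`, `|e^z − 1| ≤ 2|z|` for `|z| ≤ 1`). [folklore] -/
private theorem norm_cpow_neg_sub_succ_le {m : ℕ} (hm : 2 ≤ m) {s : ℂ} (hs : s.re = 1)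
    (hs2 : ‖s‖ ≤ 2) :
    ‖(m : ℂ) ^ (-s) - ((m + 1 : ℕ) : ℂ) ^ (-s)‖ ≤ 4 / (m : ℝ) ^ 2 := by
  have hm0 : (0 : ℝ) < m := by exact_mod_cast (by omega : 0 < m)
  have hm2 : (2 : ℝ) ≤ m := by exact_mod_cast hm
  set b : ℝ := 1 + 1 / (m : ℝ) with hb
  have hb0 : 0 < b := by positivity
  have hmC : (m : ℂ) ≠ 0 := by exact_mod_cast (by omega : m ≠ 0)
  have hprod : ((m + 1 : ℕ) : ℂ) = ((m : ℝ) : ℂ) * ((b : ℝ) : ℂ) := by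
    rw [hb]; push_cast; rw [mul_add, mul_one, mul_one_div_cancel hmC]
  have hsplit : ((m + 1 : ℕ) : ℂ) ^ (-s) = ((m : ℝ) : ℂ) ^ (-s) * ((b : ℝ) : ℂ) ^ (-s) := by
    rw [hprod, Complex.mul_cpow_ofReal_nonneg hm0.le hb0.le]
  have hmc : ((m : ℝ) : ℂ) = (m : ℂ) := by norm_cast
  have hnorm_m : ‖(m : ℂ) ^ (-s)‖ = (m : ℝ)⁻¹ := by
    rw [Complex.norm_natCast_cpow_of_pos (by omega : 0 < m), Complex.neg_re, hs,
      Real.rpow_neg_one]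
  have hbcpow : ((b : ℝ) : ℂ) ^ (-s) = Complex.exp (-s * (Real.log b : ℂ)) := by
    rw [Complex.cpow_def_of_ne_zero (by exact_mod_cast hb0.ne'), ← Complex.ofReal_log hb0.le,
      mul_comm]
  have hlogb : Real.log b ≤ 1 / m := by
    have := Real.log_le_sub_one_of_pos hb0; rw [hb] at this ⊢; linarith
  have hlogb0 : 0 ≤ Real.log b := Real.log_nonneg (by rw [hb]; linarith [one_div_pos.mpr hm0])
  have h2m : 2 * (1 / (m : ℝ)) ≤ 1 := by
    rw [mul_one_div, div_le_one hm0]; exact hm2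
  have hz : ‖-s * (Real.log b : ℂ)‖ ≤ 1 := by
    rw [norm_mul, norm_neg, Complex.norm_real, Real.norm_of_nonneg hlogb0]
    calc ‖s‖ * Real.log b ≤ 2 * (1 / m) := mul_le_mul hs2 hlogb hlogb0 (by norm_num)
      _ ≤ 1 := h2m
  have hexp : ‖Complex.exp (-s * (Real.log b : ℂ)) - 1‖ ≤ 2 * ‖-s * (Real.log b : ℂ)‖ :=
    Complex.norm_exp_sub_one_le hz
  have hz2 : ‖-s * (Real.log b : ℂ)‖ ≤ 2 * (1 / m) := by
    rw [norm_mul, norm_neg, Complex.norm_real, Real.norm_of_nonneg hlogb0]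
    exact mul_le_mul hs2 hlogb hlogb0 (by norm_num)
  calc ‖(m : ℂ) ^ (-s) - ((m + 1 : ℕ) : ℂ) ^ (-s)‖
      = ‖(m : ℂ) ^ (-s) * (1 - ((b : ℝ) : ℂ) ^ (-s))‖ := by rw [hsplit, hmc]; ring_nf
    _ = (m : ℝ)⁻¹ * ‖((b : ℝ) : ℂ) ^ (-s) - 1‖ := by rw [norm_mul, hnorm_m, norm_sub_rev]
    _ ≤ (m : ℝ)⁻¹ * (2 * (2 * (1 / m))) := by
        rw [hbcpow]
        exact mul_le_mul_of_nonneg_left (hexp.trans (by linarith)) (by positivity)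
    _ = 4 / (m : ℝ) ^ 2 := by field_simp; ring

/-- Two naturals in a real open interval of length `≤ 1` coincide. [folklore] -/
private theorem eq_of_mem_short_window {L U : ℝ} (hUL : U - L ≤ 1) {m₁ m₂ : ℕ}
    (h₁ : L < m₁ ∧ (m₁ : ℝ) < U) (h₂ : L < m₂ ∧ (m₂ : ℝ) < U) : m₁ = m₂ := by
  by_contra hne
  rcases Nat.lt_or_gt_of_ne hne with h | h
  · have : (m₁ : ℝ) + 1 ≤ m₂ := by exact_mod_cast h
    linarith [h₁.1, h₂.2]
  · have : (m₂ : ℝ) + 1 ≤ m₁ := by exact_mod_cast h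
    linarith [h₂.1, h₁.2]

/-- The integers of a window `(L, U)` with `L ≥ 1`, `U − L ≥ 1` have harmonic sum
`≤ 2(U − L)/L`. [folklore] -/
private theorem sum_window_inv_le {L U : ℝ} (hL : 1 ≤ L) (hUL : 1 ≤ U - L) (s : Finset ℕ)
    (hs : ∀ m ∈ s, L < m ∧ (m : ℝ) < U) :
    ∑ m ∈ s, (1 : ℝ) / m ≤ 2 * (U - L) / L := by
  have hL0 : 0 < L := by linarith
  have hU0 : 0 ≤ U := by linarith
  -- `s ⊆ Ioc ⌊L⌋ ⌊U⌋`, so `#s ≤ U − L + 1 ≤ 2(U − L)`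
  have hsub : s ⊆ Ioc ⌊L⌋₊ ⌊U⌋₊ := by
    intro m hm
    obtain ⟨h1, h2⟩ := hs m hm
    rw [Finset.mem_Ioc]
    exact ⟨(Nat.floor_lt hL0.le).mpr h1, Nat.le_floor h2.le⟩
  have hcard : (s.card : ℝ) ≤ 2 * (U - L) := by
    have h1 : s.card ≤ ⌊U⌋₊ - ⌊L⌋₊ := by
      have := Finset.card_le_card hsub
      rwa [Nat.card_Ioc] at this
    have hLU : ⌊L⌋₊ ≤ ⌊U⌋₊ := Nat.floor_le_floor (by linarith)
    have h2 : ((⌊U⌋₊ - ⌊L⌋₊ : ℕ) : ℝ) = (⌊U⌋₊ : ℝ) - (⌊L⌋₊ : ℝ) := by push_cast [Nat.cast_sub hLU]; ring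
    have h3 : (⌊U⌋₊ : ℝ) ≤ U := Nat.floor_le hU0
    have h4 : L < (⌊L⌋₊ : ℝ) + 1 := Nat.lt_floor_add_one L
    calc (s.card : ℝ) ≤ ((⌊U⌋₊ - ⌊L⌋₊ : ℕ) : ℝ) := by exact_mod_cast h1
      _ = (⌊U⌋₊ : ℝ) - (⌊L⌋₊ : ℝ) := h2
      _ ≤ U - L + 1 := by linarith
      _ ≤ 2 * (U - L) := by linarith
  -- each term `≤ 1/L`
  have hterm : ∀ m ∈ s, (1 : ℝ) / m ≤ 1 / L := fun m hm =>
    div_le_div_of_nonneg_left zero_le_one hL0 (hs m hm).1.le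
  calc ∑ m ∈ s, (1 : ℝ) / m ≤ ∑ m ∈ s, 1 / L := Finset.sum_le_sum hterm
    _ = s.card * (1 / L) := by rw [Finset.sum_const, nsmul_eq_mul]
    _ ≤ 2 * (U - L) * (1 / L) := mul_le_mul_of_nonneg_right hcard (by positivity)
    _ = 2 * (U - L) / L := by ring


/-! ### Part 2. The long-window `m`-sum: cancellation from the periodicity of `χ` -/

/-- **The twisted sum over a long window.** Let `χ ≠ 1` be a Dirichlet character mod `D`,
`Re s = 1`, `|s| ≤ 2`, and let `g` be supported on the integers of a window `(L, U)` with `L ≥ 4`,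
`U ≤ N`, with `|g| ≤ δ` and `|g(m') − g(m)| ≤ Λ log(m'/m)` on the window. Then
`‖∑_{m<N} χ(m)g(m)m^{−s}‖ ≤ 2D(Λ + 5δ)/(L − 1)` — Abel summation (the tree's
`SiegelZero.sum_Ioc_mul_eq_abel`) against the window sums `|∑_{A<k≤m} χ(k)| ≤ 2D`
(`SiegelZero.norm_sum_Ioc_apply_le`); the variation of `g(m)m^{−s}` over the window is
`≤ (Λ + 4δ)/⌊L⌋ + δ/⌊L⌋` (one boundary jump). [cite: Zhang2022LandauSiegel, §11 p. 64] -/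
theorem norm_sum_window_twist_le {D : ℕ} [NeZero D] (χ : DirichletCharacter ℂ D) (hχ : χ ≠ 1)
    {s : ℂ}
    (hs : s.re = 1) (hs2 : ‖s‖ ≤ 2) {L U δ Λ : ℝ} (hL : 4 ≤ L) (hδ : 0 ≤ δ) (hΛ : 0 ≤ Λ)
    {N : ℕ} (hUN : U ≤ N) (g : ℕ → ℂ) (hg0 : ∀ m : ℕ, ¬(L < m ∧ (m : ℝ) < U) → g m = 0)
    (hgδ : ∀ m, ‖g m‖ ≤ δ)
    (hgΛ : ∀ m m' : ℕ, L < m → m ≤ m' → (m' : ℝ) < U →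
      ‖g m' - g m‖ ≤ Λ * Real.log ((m' : ℝ) / m)) :
    ‖∑ m ∈ Ico 1 N, χ (m : ZMod D) * g m / (m : ℂ) ^ s‖ ≤ 2 * D * (Λ + 5 * δ) / (L - 1) := by
  classical
  set A : ℕ := ⌊L⌋₊ with hA
  set B : ℕ := ⌊U⌋₊ with hB
  have hL0 : 0 ≤ L := by linarith
  have hA4 : 4 ≤ A := by
    rw [hA]; exact Nat.le_floor (by exact_mod_cast hL)
  have hAL : (A : ℝ) ≤ L := Nat.floor_le hL0
  have hLA : L < (A : ℝ) + 1 := Nat.lt_floor_add_one L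
  have hA0 : (0 : ℝ) < A := by exact_mod_cast (by omega : 0 < A)
  have hD0 : (0 : ℝ) ≤ D := Nat.cast_nonneg D
  set a : ℕ → ℂ := fun m => g m / (m : ℂ) ^ s with ha
  have hwin_of_ne : ∀ m : ℕ, g m ≠ 0 → L < m ∧ (m : ℝ) < U := fun m hm => by
    by_contra h; exact hm (hg0 m h)
  -- Step 1: both sums run over the support of `g`, which lies in `Ioc A B ∩ Ico 1 N`
  have hsum_eq : ∑ m ∈ Ico 1 N, χ (m : ZMod D) * g m / (m : ℂ) ^ s =
      ∑ m ∈ Ioc A B, χ (m : ZMod D) * a m := by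
    have e1 : ∀ m : ℕ, χ (m : ZMod D) * g m / (m : ℂ) ^ s = χ (m : ZMod D) * a m := fun m => by
      simp only [ha]; ring
    simp_rw [e1]
    rw [← Finset.sum_filter_ne_zero (s := Ico 1 N), ← Finset.sum_filter_ne_zero (s := Ioc A B)]
    refine Finset.sum_congr ?_ fun _ _ => rfl
    ext m
    simp only [Finset.mem_filter, Finset.mem_Ico, Finset.mem_Ioc]
    have key : χ (m : ZMod D) * a m ≠ 0 → (A < m ∧ m ≤ B) ∧ (1 ≤ m ∧ m < N) := by
      intro hne
      have hgm : g m ≠ 0 := by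
        intro h0; apply hne; simp [ha, h0]
      obtain ⟨h1, h2⟩ := hwin_of_ne m hgm
      have hm1 : 1 ≤ m := by
        have : (1 : ℝ) ≤ m := by linarith
        exact_mod_cast this
      have hmN : m < N := by
        have : (m : ℝ) < N := lt_of_lt_of_le h2 hUN
        exact_mod_cast this
      exact ⟨⟨(Nat.floor_lt hL0).mpr h1, Nat.le_floor h2.le⟩, hm1, hmN⟩
    constructor
    · rintro ⟨-, hne⟩; exact ⟨(key hne).1, hne⟩
    · rintro ⟨-, hne⟩; exact ⟨(key hne).2, hne⟩
  rw [hsum_eq]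
  rcases le_or_gt A B with hAB | hAB
  swap
  · rw [Finset.Ioc_eq_empty (by omega), Finset.sum_empty, norm_zero]
    exact div_nonneg (by positivity) (by linarith)
  rw [SiegelZero.sum_Ioc_mul_eq_abel χ a hAB]
  have haB : a (B + 1) = 0 := by
    have hg : g (B + 1) = 0 := hg0 _ (by
      rintro ⟨-, h2⟩
      have := Nat.lt_floor_add_one U
      push_cast at h2
      rw [hB] at h2
      linarith)
    simp [ha, hg]
  rw [haB, mul_zero, zero_add]
  have hS : ∀ n, ‖∑ k ∈ Ioc A n, χ (k : ZMod D)‖ ≤ 2 * D := fun n =>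
    SiegelZero.norm_sum_Ioc_apply_le χ hχ A n
  -- Step 2: the variation of `a` over the window
  set P : ℕ → Prop := fun m =>
    (L < m ∧ (m : ℝ) < U) ∧ ¬(L < ((m + 1 : ℕ) : ℝ) ∧ ((m + 1 : ℕ) : ℝ) < U) with hP
  have hvar : ∀ m ∈ Ioc A B,
      ‖a m - a (m + 1)‖ ≤ (Λ + 4 * δ) * (1 / (m : ℝ) ^ 2) + (if P m then δ / A else 0) := by
    intro m hm
    have hmA : A < m := (Finset.mem_Ioc.mp hm).1
    have hmA' : (A : ℝ) + 1 ≤ m := by exact_mod_cast hmA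
    have hmL : L < m := by linarith
    have hm2 : 2 ≤ m := by omega
    have hm0 : (0 : ℝ) < m := by linarith
    have hmAr : (A : ℝ) ≤ m := by linarith
    have hcpow : ‖(m : ℂ) ^ (-s)‖ = (m : ℝ)⁻¹ := by
      rw [Complex.norm_natCast_cpow_of_pos (by omega : 0 < m), Complex.neg_re, hs,
        Real.rpow_neg_one]
    have ha_m : a m = g m * (m : ℂ) ^ (-s) := by
      simp only [ha, div_eq_mul_inv, Complex.cpow_neg]
    have ha_m1 : a (m + 1) = g (m + 1) * ((m + 1 : ℕ) : ℂ) ^ (-s) := by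
      simp only [ha, div_eq_mul_inv, Complex.cpow_neg]
    have hRHS0 : 0 ≤ (Λ + 4 * δ) * (1 / (m : ℝ) ^ 2) := by positivity
    by_cases hWm : L < m ∧ (m : ℝ) < U
    · by_cases hW1 : L < ((m + 1 : ℕ) : ℝ) ∧ ((m + 1 : ℕ) : ℝ) < U
      · -- both `m` and `m+1` in the window
        have hP' : ¬ P m := fun h => h.2 hW1
        rw [if_neg hP', add_zero]
        have e : a m - a (m + 1) = (g m - g (m + 1)) * (m : ℂ) ^ (-s) +
            g (m + 1) * ((m : ℂ) ^ (-s) - ((m + 1 : ℕ) : ℂ) ^ (-s)) := by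
          rw [ha_m, ha_m1]; ring
        have hlog : Real.log (((m + 1 : ℕ) : ℝ) / m) ≤ 1 / m := by
          have e2 : ((m + 1 : ℕ) : ℝ) / m = 1 + 1 / m := by
            push_cast; field_simp
          rw [e2]
          have := Real.log_le_sub_one_of_pos (show (0 : ℝ) < 1 + 1 / m by positivity)
          linarith
        have hg1 : ‖g m - g (m + 1)‖ ≤ Λ * (1 / m) := by
          rw [norm_sub_rev]
          exact (hgΛ m (m + 1) hmL (Nat.le_succ m) hW1.2).trans
            (mul_le_mul_of_nonneg_left hlog hΛ)
        have hg2 : ‖g (m + 1)‖ ≤ δ := hgδ _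
        have hdiff := norm_cpow_neg_sub_succ_le hm2 hs hs2
        calc ‖a m - a (m + 1)‖
            ≤ ‖(g m - g (m + 1)) * (m : ℂ) ^ (-s)‖ +
                ‖g (m + 1) * ((m : ℂ) ^ (-s) - ((m + 1 : ℕ) : ℂ) ^ (-s))‖ := by
              rw [e]; exact norm_add_le _ _
          _ ≤ Λ * (1 / m) * (m : ℝ)⁻¹ + δ * (4 / (m : ℝ) ^ 2) := by
              rw [norm_mul, norm_mul, hcpow]
              exact add_le_add (mul_le_mul_of_nonneg_right hg1 (by positivity))
                (mul_le_mul hg2 hdiff (norm_nonneg _) hδ)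
          _ = (Λ + 4 * δ) * (1 / (m : ℝ) ^ 2) := by field_simp
      · -- `m` in, `m + 1` out: the boundary jump
        have hP' : P m := ⟨hWm, hW1⟩
        rw [if_pos hP']
        have h0 : a (m + 1) = 0 := by rw [ha_m1, hg0 _ hW1, zero_mul]
        rw [h0, sub_zero, ha_m, norm_mul, hcpow]
        calc ‖g m‖ * (m : ℝ)⁻¹ ≤ δ * (A : ℝ)⁻¹ :=
              mul_le_mul (hgδ m) ((inv_le_inv₀ hm0 hA0).mpr hmAr) (by positivity) hδ
          _ = δ / A := by rw [div_eq_mul_inv]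
          _ ≤ (Λ + 4 * δ) * (1 / (m : ℝ) ^ 2) + δ / A := by linarith
    · -- `m` out: then `m + 1` is out as well and both terms vanish
      have hW1 : ¬(L < ((m + 1 : ℕ) : ℝ) ∧ ((m + 1 : ℕ) : ℝ) < U) := by
        rintro ⟨-, h2⟩
        apply hWm
        refine ⟨hmL, ?_⟩
        push_cast at h2
        linarith
      rw [ha_m, ha_m1, hg0 _ hWm, hg0 _ hW1, zero_mul, zero_mul, sub_zero, norm_zero]
      positivity
  -- Step 3: at most one boundary jump
  have hcard : ((Ioc A B).filter P).card ≤ 1 := by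
    refine Finset.card_le_one.mpr fun m₁ hm₁ m₂ hm₂ => ?_
    rw [Finset.mem_filter] at hm₁ hm₂
    by_contra hne
    rcases Nat.lt_or_gt_of_ne hne with h | h
    · apply hm₁.2.2
      refine ⟨?_, ?_⟩
      · have := hm₁.2.1.1; push_cast; linarith
      · have h2 := hm₂.2.1.2
        have : ((m₁ + 1 : ℕ) : ℝ) ≤ m₂ := by exact_mod_cast h
        linarith
    · apply hm₂.2.2
      refine ⟨?_, ?_⟩
      · have := hm₂.2.1.1; push_cast; linarith
      · have h2 := hm₁.2.1.2
        have : ((m₂ + 1 : ℕ) : ℝ) ≤ m₁ := by exact_mod_cast h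
        linarith
  have hjump : ∑ m ∈ Ioc A B, (if P m then δ / A else (0 : ℝ)) ≤ δ / A := by
    rw [← Finset.sum_filter, Finset.sum_const, nsmul_eq_mul]
    calc (((Ioc A B).filter P).card : ℝ) * (δ / A) ≤ 1 * (δ / A) := by
          refine mul_le_mul_of_nonneg_right ?_ (by positivity)
          exact_mod_cast hcard
      _ = δ / A := one_mul _
  -- Step 4: sum up
  have hA1 : 1 ≤ A := by omega
  calc ‖∑ m ∈ Ioc A B, (∑ k ∈ Ioc A m, χ (k : ZMod D)) * (a m - a (m + 1))‖
      ≤ ∑ m ∈ Ioc A B, ‖(∑ k ∈ Ioc A m, χ (k : ZMod D)) * (a m - a (m + 1))‖ :=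
        norm_sum_le _ _
    _ ≤ ∑ m ∈ Ioc A B,
          2 * D * ((Λ + 4 * δ) * (1 / (m : ℝ) ^ 2) + (if P m then δ / A else 0)) :=
        Finset.sum_le_sum fun m hm => by
          rw [norm_mul]
          exact mul_le_mul (hS m) (hvar m hm) (norm_nonneg _) (by positivity)
    _ = 2 * D * ((Λ + 4 * δ) * ∑ m ∈ Ioc A B, (1 / (m : ℝ) ^ 2) +
          ∑ m ∈ Ioc A B, (if P m then δ / A else (0 : ℝ))) := by
        rw [← Finset.mul_sum, Finset.sum_add_distrib, Finset.mul_sum]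
    _ ≤ 2 * D * ((Λ + 4 * δ) * (1 / A) + δ / A) := by
        gcongr
        · exact sum_Ioc_inv_sq_le hA1
    _ = 2 * D * (Λ + 5 * δ) / A := by
        field_simp
        ring
    _ ≤ 2 * D * (Λ + 5 * δ) / (L - 1) :=
        div_le_div_of_nonneg_left (by positivity) (by linarith) (by linarith)


/-! ### Part 3. The pieces of `S_j(𝐛, 𝐛̄)` for a window sequence `b = χ·w` -/

/-- `Xη₋ < km < Xη₊` iff `Xη₋/k < m < Xη₊/k` (`k ≥ 1`). [folklore] -/
private theorem window_div_iff {X ηm ηp : ℝ} {k : ℕ} (hk : 1 ≤ k) (m : ℕ) :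
    (X * ηm < ((k * m : ℕ) : ℝ) ∧ ((k * m : ℕ) : ℝ) < X * ηp) ↔
      (X * ηm / k < m ∧ (m : ℝ) < X * ηp / k) := by
  have hk0 : (0 : ℝ) < k := by exact_mod_cast hk
  push_cast
  rw [div_lt_iff₀ hk0, lt_div_iff₀ hk0, mul_comm (m : ℝ) k]

/-- A uniform constant for the `T`-free logarithmic mean of `ξ₀ⱼ`: `Σ_{n≤X}‖ξ₀ⱼ(n;d,r)‖/n ≤ E(log X)⁵`
(`X ≥ 2`), `E` independent of `c′, D, j, d, r` (the tree's `sum_norm_xiZero_div_le`).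
[cite: Zhang2022LandauSiegel, §7 p.33] -/
theorem exists_sum_norm_xiZero_div_le : ∃ E : ℝ, 0 ≤ E ∧ ∀ (c' : ℝ) (D X : ℕ), 2 ≤ X →
    ∀ j d r : ℕ, ∑ n ∈ Icc 1 X, ‖xiZero c' D j n d r‖ / n ≤ E * Real.log X ^ 5 := by
  refine ⟨Real.exp (4 * (5 : ℕ) + (60 + 7 * M0) +
    7 * (2 + LogEulerProduct.tailConst 3) * LogEulerProduct.tailConst 4), (Real.exp_pos _).le,
    fun c' D X hX j d r => ?_⟩
  have h := sum_norm_xiZero_div_le c' D hX j d r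
  simp only [zero_mul, add_zero] at h
  exact h

/-- A uniform linear bound for the majorant `gC`: `gC(n) ≤ A·n` (`n ≥ 1`), `A` independent of
`c′, D` (divisor class, `Sieve.ShiuDivisorClass.exists_rpow_majorant` at `δ = 1`).
[cite: Zhang2022LandauSiegel, §7 p.33] -/
theorem exists_gC_le_linear : ∃ A : ℝ, 0 ≤ A ∧ ∀ (c' : ℝ) (D n : ℕ), 1 ≤ n →
    gC c' D n ≤ A * n := by
  obtain ⟨A₂, hA₂⟩ := Literature.NumberTheory.Sieve.ShiuDivisorClass.exists_rpow_majorant 4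
    (7 * (2 + LogEulerProduct.tailConst 3))
  have key : ∀ (c' : ℝ) (D n : ℕ), 1 ≤ n → gC c' D n ≤ A₂ 1 * n := by
    intro c' D n hn
    have h := hA₂ (fun n => gC c' D n) (gC_nonneg c' D)
      (fun m n hmn => (isMultiplicative_gC c' D).map_mul_of_coprime hmn)
      (fun p ν hp _ => gC_prime_pow_le c' D hp ν) 1 one_pos n hn
    simpa using h
  refine ⟨max (A₂ 1) 0, le_max_right _ _, fun c' D n hn => (key c' D n hn).trans ?_⟩
  exact mul_le_mul_of_nonneg_right (le_max_left _ _) (Nat.cast_nonneg n)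

section Pieces

variable (c' : ℝ) {D : ℕ} (χ : DirichletCharacter ℂ D)

/-- The weight of `S_j`: `‖ |μ(r)|λ₀ⱼ(dr)/(drφ(r)) ‖ ≤ (Λc(d)/d)·(|μ(r)|Λc(r)/(rφ(r)))`
(`d, r ≥ 1`). [cite: Zhang2022LandauSiegel, §7 Prop. 7.1 p.33] -/
theorem norm_weight_le {d r : ℕ} (hd : d ≠ 0) (hr : r ≠ 0) (j : ℕ) :
    ‖((ArithmeticFunction.moebius r).natAbs : ℂ) * lamZero c' D j (d * r) /
        ((d * r : ℕ) * (Nat.totient r : ℂ))‖ ≤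
      (LamC d / d) * (((ArithmeticFunction.moebius r).natAbs : ℝ) * LamC r /
        ((r : ℝ) * (Nat.totient r : ℝ))) := by
  have hdpos : (0 : ℝ) < d := by exact_mod_cast Nat.pos_of_ne_zero hd
  have hrpos : (0 : ℝ) < r := by exact_mod_cast Nat.pos_of_ne_zero hr
  have hφpos : (0 : ℝ) < Nat.totient r := by
    exact_mod_cast Nat.totient_pos.mpr (Nat.pos_of_ne_zero hr)
  rw [norm_div, norm_mul, norm_mul, Complex.norm_natCast, Complex.norm_natCast,
    Complex.norm_natCast]
  push_cast
  have hlam : ‖lamZero c' D j (d * r)‖ ≤ LamC d * LamC r :=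
    (norm_lamZero_le_LamC c' D (mul_ne_zero hd hr) j).trans (LamC_mul_le hd hr)
  have hμ0 : (0 : ℝ) ≤ ((ArithmeticFunction.moebius r).natAbs : ℝ) := Nat.cast_nonneg _
  calc ((ArithmeticFunction.moebius r).natAbs : ℝ) * ‖lamZero c' D j (d * r)‖ /
        ((d : ℝ) * r * Nat.totient r)
      ≤ ((ArithmeticFunction.moebius r).natAbs : ℝ) * (LamC d * LamC r) /
          ((d : ℝ) * r * Nat.totient r) := by gcongr
    _ = (LamC d / d) * (((ArithmeticFunction.moebius r).natAbs : ℝ) * LamC r /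
          ((r : ℝ) * (Nat.totient r : ℝ))) := by
        field_simp

/-- The `n`-sum against a window sequence: `‖Σ_n conj(b(kn))ξ₀ⱼ(n;d,r)/n‖ ≤ δ·Σ_{kn∈window}‖ξ₀ⱼ‖/n`.
[cite: Zhang2022LandauSiegel, §7 Prop. 7.1 p.33] -/
theorem norm_nsum_le {X δ : ℝ} (w : ℕ → ℂ)
    (hw0 : ∀ n : ℕ, ¬(X * etaPM D (-1) < n ∧ (n : ℝ) < X * etaPM D 1) → w n = 0)
    (hwδ : ∀ n, ‖w n‖ ≤ δ) (j d r N k : ℕ) :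
    ‖∑ n ∈ Ico 1 N, conj (χ ((k * n : ℕ) : ZMod D) * w (k * n)) * xiZero c' D j n d r /
        (n : ℂ)‖ ≤
      δ * ∑ n ∈ (Ico 1 N).filter (fun n : ℕ => X * etaPM D (-1) < ((k * n : ℕ) : ℝ) ∧
        ((k * n : ℕ) : ℝ) < X * etaPM D 1), ‖xiZero c' D j n d r‖ / n := by
  classical
  rw [Finset.sum_filter, Finset.mul_sum]
  refine (norm_sum_le _ _).trans (Finset.sum_le_sum fun n _ => ?_)
  split_ifs with hW
  · rw [norm_div, norm_mul, Complex.norm_natCast, RCLike.norm_conj, norm_mul]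
    have h1 : ‖χ ((k * n : ℕ) : ZMod D)‖ * ‖w (k * n)‖ ≤ 1 * δ :=
      mul_le_mul (DirichletCharacter.norm_le_one χ _) (hwδ _) (norm_nonneg _) zero_le_one
    rw [one_mul] at h1
    rw [mul_div_assoc]
    exact mul_le_mul_of_nonneg_right h1 (by positivity)
  · have h0 : w (k * n) = 0 := hw0 _ (by exact_mod_cast hW)
    simp [h0]

/-- The `m`-sum against a window sequence, trivially: `‖Σ_m b(km)m^{−(1−β_j)}‖ ≤ δ·Σ_{km∈window} 1/m`.
[cite: Zhang2022LandauSiegel, §7 Prop. 7.1 p.33] -/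
theorem norm_msum_le_trivial {X δ : ℝ} (w : ℕ → ℂ)
    (hw0 : ∀ n : ℕ, ¬(X * etaPM D (-1) < n ∧ (n : ℝ) < X * etaPM D 1) → w n = 0)
    (hwδ : ∀ n, ‖w n‖ ≤ δ) (j N k : ℕ) :
    ‖∑ m ∈ Ico 1 N, χ ((k * m : ℕ) : ZMod D) * w (k * m) / (m : ℂ) ^ (1 - betaJ c' D j)‖ ≤
      δ * ∑ m ∈ (Ico 1 N).filter (fun m : ℕ => X * etaPM D (-1) < ((k * m : ℕ) : ℝ) ∧
        ((k * m : ℕ) : ℝ) < X * etaPM D 1), (1 : ℝ) / m := by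
  classical
  rw [Finset.sum_filter, Finset.mul_sum]
  refine (norm_sum_le _ _).trans (Finset.sum_le_sum fun m hm => ?_)
  have hmpos : 0 < m := (Finset.mem_Ico.mp hm).1
  split_ifs with hW
  · rw [norm_div, norm_mul, Complex.norm_natCast_cpow_of_pos hmpos, one_sub_betaJ_re,
      Real.rpow_one]
    have h1 : ‖χ ((k * m : ℕ) : ZMod D)‖ * ‖w (k * m)‖ ≤ 1 * δ :=
      mul_le_mul (DirichletCharacter.norm_le_one χ _) (hwδ _) (norm_nonneg _) zero_le_one
    rw [one_mul] at h1
    rw [mul_one_div]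
    exact div_le_div_of_nonneg_right h1 (Nat.cast_nonneg m)
  · have h0 : w (k * m) = 0 := hw0 _ (by exact_mod_cast hW)
    simp [h0]

/-- The `m`-sum against a window sequence over a LONG window (`Xη₋/k ≥ 4`): by the periodicity of
`χ` (`norm_sum_window_twist_le`), `‖Σ_m b(km)m^{−(1−β_j)}‖ ≤ 2D(Λ+5δ)/(Xη₋/k − 1)`.
[cite: Zhang2022LandauSiegel, §11 p. 64] -/
theorem norm_msum_le_long [NeZero D] (hχ : χ ≠ 1) (j : ℕ) (hB : Bsum c' D ≤ 1)
    {X δ Λ : ℝ} (hδ : 0 ≤ δ) (hΛ : 0 ≤ Λ) (w : ℕ → ℂ)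
    (hw0 : ∀ n : ℕ, ¬(X * etaPM D (-1) < n ∧ (n : ℝ) < X * etaPM D 1) → w n = 0)
    (hwδ : ∀ n, ‖w n‖ ≤ δ)
    (hwΛ : ∀ n n' : ℕ, X * etaPM D (-1) < n → n ≤ n' → (n' : ℝ) < X * etaPM D 1 →
      ‖w n' - w n‖ ≤ Λ * Real.log ((n' : ℝ) / n))
    {N : ℕ} (hXN : X * etaPM D 1 ≤ N) {k : ℕ} (hk : 1 ≤ k) (hL : 4 ≤ X * etaPM D (-1) / k) :
    ‖∑ m ∈ Ico 1 N, χ ((k * m : ℕ) : ZMod D) * w (k * m) / (m : ℂ) ^ (1 - betaJ c' D j)‖ ≤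
      2 * D * (Λ + 5 * δ) / (X * etaPM D (-1) / k - 1) := by
  have hk0 : (0 : ℝ) < k := by exact_mod_cast hk
  set L : ℝ := X * etaPM D (-1) / k with hLdef
  set U : ℝ := X * etaPM D 1 / k with hUdef
  set s : ℂ := 1 - betaJ c' D j with hsdef
  have hs : s.re = 1 := one_sub_betaJ_re c' D j
  have hs2 : ‖s‖ ≤ 2 := by
    rw [hsdef, betaJ_eq]
    calc ‖(1 : ℂ) - (bJ c' D j : ℂ) * Complex.I‖ ≤ ‖(1 : ℂ)‖ + ‖(bJ c' D j : ℂ) * Complex.I‖ :=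
          norm_sub_le _ _
      _ = 1 + |bJ c' D j| := by
          rw [norm_one, norm_mul, Complex.norm_I, mul_one, Complex.norm_real, Real.norm_eq_abs]
      _ ≤ 1 + 1 := by linarith [abs_bJ_le c' D j]
      _ = 2 := by norm_num
  have hUN : U ≤ N := by
    rw [hUdef]
    have hη : 0 < etaPM D 1 := Real.exp_pos _
    have hX0 : 0 ≤ X * etaPM D 1 := by
      have : 0 < X * etaPM D (-1) / k := by linarith
      have hηm : 0 < etaPM D (-1) := Real.exp_pos _
      have hX : 0 < X := by
        by_contra hX
        push Not at hX
        have : X * etaPM D (-1) / k ≤ 0 :=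
          div_nonpos_of_nonpos_of_nonneg (mul_nonpos_of_nonpos_of_nonneg hX hηm.le) hk0.le
        linarith
      positivity
    exact (div_le_self hX0 (by exact_mod_cast hk)).trans hXN
  -- `b(km) = χ(k)χ(m)w(km)`
  set g : ℕ → ℂ := fun m => w (k * m) with hg
  have hfac : ∑ m ∈ Ico 1 N, χ ((k * m : ℕ) : ZMod D) * w (k * m) / (m : ℂ) ^ s =
      χ (k : ZMod D) * ∑ m ∈ Ico 1 N, χ (m : ZMod D) * g m / (m : ℂ) ^ s := by
    rw [Finset.mul_sum]
    refine Finset.sum_congr rfl fun m _ => ?_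
    rw [Nat.cast_mul, map_mul, hg]
    ring
  have hg0 : ∀ m : ℕ, ¬(L < m ∧ (m : ℝ) < U) → g m = 0 := by
    intro m hm
    apply hw0
    rw [window_div_iff hk m]
    exact hm
  have hgδ : ∀ m, ‖g m‖ ≤ δ := fun m => hwδ _
  have hgΛ : ∀ m m' : ℕ, L < m → m ≤ m' → (m' : ℝ) < U →
      ‖g m' - g m‖ ≤ Λ * Real.log ((m' : ℝ) / m) := by
    intro m m' hm hmm' hm'
    have hm0 : (0 : ℝ) < m := by
      have hL4 : (4 : ℝ) ≤ L := hL
      linarith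
    have h1 : X * etaPM D (-1) < ((k * m : ℕ) : ℝ) :=
      ((window_div_iff hk m).mpr ⟨hm, lt_of_le_of_lt (by exact_mod_cast hmm') hm'⟩).1
    have h2 : ((k * m' : ℕ) : ℝ) < X * etaPM D 1 :=
      ((window_div_iff hk m').mpr ⟨lt_of_lt_of_le hm (by exact_mod_cast hmm'), hm'⟩).2
    have h3 : k * m ≤ k * m' := Nat.mul_le_mul_left k hmm'
    have key := hwΛ (k * m) (k * m') h1 h3 h2
    have e : (((k * m' : ℕ) : ℝ)) / ((k * m : ℕ) : ℝ) = (m' : ℝ) / m := by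
      push_cast
      rw [mul_div_mul_left _ _ hk0.ne']
    rw [e] at key
    exact key
  have hmain := norm_sum_window_twist_le χ hχ hs hs2 hL hδ hΛ hUN g hg0 hgδ hgΛ
  rw [hfac, norm_mul]
  calc ‖χ (k : ZMod D)‖ * ‖∑ m ∈ Ico 1 N, χ (m : ZMod D) * g m / (m : ℂ) ^ s‖
      ≤ 1 * (2 * D * (Λ + 5 * δ) / (L - 1)) :=
        mul_le_mul (DirichletCharacter.norm_le_one χ _) hmain (norm_nonneg _) zero_le_one
    _ = 2 * D * (Λ + 5 * δ) / (X * etaPM D (-1) / k - 1) := by rw [one_mul]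


/-- **The product of the two inner sums, per `(d, r)`.** For the window sequence `b = χ·w` and
`k = dr`, with `L = Xη₋/k`: if `L ≥ D²` the `m`-sum is `≤ 20(δ+Λ)/D` (periodicity of `χ`) and the
`n`-sum is `≤ δE(log N)⁵`; if `L < D²` and the window `(L, Lη₊/η₋)` has length `≥ 1`, the `m`-sum is
`≤ 2δ(η₊/η₋ − 1)` and the `n`-sum `≤ δE(log 2D²)⁵`; if the length is `< 1` both sums have at most ONE
term `n₀` and the product is `≤ δ·δA` (`|ξ₀ⱼ(n₀)| ≤ gC(n₀) ≤ An₀`).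
[cite: Zhang2022LandauSiegel, §7 Prop. 7.1 p.33; §11 p.64] -/
theorem msum_mul_nsum_le [NeZero D] (hχ : χ ≠ 1) (j : ℕ) (hB : Bsum c' D ≤ 1) (hD2 : 2 ≤ D)
    {N : ℕ} (hN2 : 2 ≤ N) {X δ Λ : ℝ} (hX : 0 < X) (hδ : 0 ≤ δ) (hΛ : 0 ≤ Λ)
    (hXN : X * etaPM D 1 ≤ N) {θ : ℝ} (hθ : etaPM D 1 / etaPM D (-1) - 1 ≤ θ) (hθ1 : θ ≤ 1)
    {E : ℝ} (hE0 : 0 ≤ E)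
    (hE : ∀ Y : ℕ, 2 ≤ Y → ∀ d r : ℕ, ∑ n ∈ Icc 1 Y, ‖xiZero c' D j n d r‖ / n ≤ E * Real.log Y ^ 5)
    {A : ℝ} (hA0 : 0 ≤ A) (hA : ∀ n : ℕ, 1 ≤ n → gC c' D n ≤ A * n)
    (w : ℕ → ℂ) (hw0 : ∀ n : ℕ, ¬(X * etaPM D (-1) < n ∧ (n : ℝ) < X * etaPM D 1) → w n = 0)
    (hwδ : ∀ n, ‖w n‖ ≤ δ)
    (hwΛ : ∀ n n' : ℕ, X * etaPM D (-1) < n → n ≤ n' → (n' : ℝ) < X * etaPM D 1 →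
      ‖w n' - w n‖ ≤ Λ * Real.log ((n' : ℝ) / n))
    {d r : ℕ} (hd : 1 ≤ d) (hr : 1 ≤ r) :
    ‖∑ m ∈ Ico 1 N, χ ((d * r * m : ℕ) : ZMod D) * w (d * r * m) /
        (m : ℂ) ^ (1 - betaJ c' D j)‖ *
      ∑ n ∈ (Ico 1 N).filter (fun n : ℕ => X * etaPM D (-1) < ((d * r * n : ℕ) : ℝ) ∧
        ((d * r * n : ℕ) : ℝ) < X * etaPM D 1), ‖xiZero c' D j n d r‖ / n ≤
      (δ + Λ) * (20 * E * Real.log N ^ 5 / D + 2 * θ * (E * Real.log (2 * (D : ℝ) ^ 2) ^ 5) + A) := by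
  classical
  have hk : 1 ≤ d * r := Nat.one_le_iff_ne_zero.mpr (mul_ne_zero (by omega) (by omega))
  have hk0 : (0 : ℝ) < ((d * r : ℕ) : ℝ) := by exact_mod_cast hk
  have hηm : 0 < etaPM D (-1) := Real.exp_pos _
  have hηp : 0 < etaPM D 1 := Real.exp_pos _
  have hD0 : (0 : ℝ) < D := by exact_mod_cast (by omega : 0 < D)
  have hD2r : (2 : ℝ) ≤ D := by exact_mod_cast hD2
  set L : ℝ := X * etaPM D (-1) / (d * r : ℕ) with hLdef
  set U : ℝ := X * etaPM D 1 / (d * r : ℕ) with hUdef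
  have hL0 : 0 < L := by positivity
  have hθ0 : 0 ≤ θ := by
    have : 1 ≤ etaPM D 1 / etaPM D (-1) := by
      rw [le_div_iff₀ hηm, one_mul, etaPM, etaPM]
      exact Real.exp_le_exp.mpr (by
        have : 0 < (ell D ^ 10)⁻¹ := by
          have h3 : 0 < ell D := by
            rw [ell]; exact Real.log_pos (by exact_mod_cast (by omega : 1 < D))
          positivity
        linarith)
    linarith
  have hUL : U - L = L * (etaPM D 1 / etaPM D (-1) - 1) := by
    rw [hLdef, hUdef]; field_simp
  have hUL' : U - L ≤ L * θ := by rw [hUL]; exact mul_le_mul_of_nonneg_left hθ hL0.le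
  have hLθ : L * θ ≤ L * 1 := mul_le_mul_of_nonneg_left hθ1 hL0.le
  have hU2L : U ≤ 2 * L := by linarith
  have hD4 : (4 : ℝ) ≤ (D : ℝ) ^ 2 := by
    have := pow_le_pow_left₀ (by norm_num : (0 : ℝ) ≤ 2) hD2r 2
    norm_num at this
    exact this
  set S : Finset ℕ := (Ico 1 N).filter (fun n : ℕ => X * etaPM D (-1) < ((d * r * n : ℕ) : ℝ) ∧
    ((d * r * n : ℕ) : ℝ) < X * etaPM D 1) with hSdef
  have hmemS : ∀ n ∈ S, L < n ∧ (n : ℝ) < U := fun n hn =>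
    (window_div_iff hk n).mp (Finset.mem_filter.mp hn).2
  set M : ℝ := ‖∑ m ∈ Ico 1 N, χ ((d * r * m : ℕ) : ZMod D) * w (d * r * m) /
    (m : ℂ) ^ (1 - betaJ c' D j)‖ with hMdef
  set G : ℝ := ∑ n ∈ S, ‖xiZero c' D j n d r‖ / n with hGdef
  have hG0 : 0 ≤ G := Finset.sum_nonneg fun n _ => by positivity
  have hM0 : 0 ≤ M := norm_nonneg _
  have hMtriv : M ≤ δ * ∑ m ∈ S, (1 : ℝ) / m :=
    norm_msum_le_trivial c' χ w hw0 hwδ j N (d * r)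
  -- the three nonnegative pieces of the right side
  have hR1 : 0 ≤ 20 * E * Real.log N ^ 5 / D := by
    have : 0 ≤ Real.log N := Real.log_nonneg (by exact_mod_cast (by omega : 1 ≤ N))
    positivity
  have hlog2D : 0 ≤ Real.log (2 * (D : ℝ) ^ 2) := Real.log_nonneg (by linarith)
  have hR2 : 0 ≤ 2 * θ * (E * Real.log (2 * (D : ℝ) ^ 2) ^ 5) := by positivity
  have hδΛ : δ ≤ δ + Λ := by linarith
  by_cases hcase : (D : ℝ) ^ 2 ≤ L
  · -- Case A: long window
    have hL4 : 4 ≤ L := le_trans hD4 hcase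
    have hMlong : M ≤ 2 * D * (Λ + 5 * δ) / (L - 1) :=
      norm_msum_le_long c' χ hχ j hB hδ hΛ w hw0 hwδ hwΛ hXN hk hL4
    have hL1 : (D : ℝ) ^ 2 / 2 ≤ L - 1 := by linarith
    have hM' : M ≤ 20 * (δ + Λ) / D := by
      calc M ≤ 2 * D * (Λ + 5 * δ) / (L - 1) := hMlong
        _ ≤ 2 * D * (Λ + 5 * δ) / ((D : ℝ) ^ 2 / 2) :=
            div_le_div_of_nonneg_left (by positivity) (by positivity) hL1
        _ = 4 * (Λ + 5 * δ) / D := by field_simp; ring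
        _ ≤ 20 * (δ + Λ) / D := by
            refine div_le_div_of_nonneg_right ?_ hD0.le; linarith
    have hG' : G ≤ E * Real.log N ^ 5 := by
      calc G ≤ ∑ n ∈ Ico 1 N, ‖xiZero c' D j n d r‖ / n :=
            Finset.sum_le_sum_of_subset_of_nonneg (Finset.filter_subset _ _)
              fun n _ _ => by positivity
        _ ≤ ∑ n ∈ Icc 1 N, ‖xiZero c' D j n d r‖ / n :=
            Finset.sum_le_sum_of_subset_of_nonneg
              (fun n hn => by
                rw [Finset.mem_Ico] at hn; rw [Finset.mem_Icc]; omega)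
              fun n _ _ => by positivity
        _ ≤ E * Real.log N ^ 5 := hE N hN2 d r
    calc M * G ≤ (20 * (δ + Λ) / D) * (E * Real.log N ^ 5) := mul_le_mul hM' hG' hG0 (by positivity)
      _ = (δ + Λ) * (20 * E * Real.log N ^ 5 / D) := by ring
      _ ≤ (δ + Λ) * (20 * E * Real.log N ^ 5 / D +
            2 * θ * (E * Real.log (2 * (D : ℝ) ^ 2) ^ 5) + A) := by
          refine mul_le_mul_of_nonneg_left ?_ (by positivity); linarith
  · -- Case B: short window, `U ≤ 2L < 2D²`
    push Not at hcase
    have hU2 : U ≤ 2 * (D : ℝ) ^ 2 := by linarith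
    by_cases hB1 : 1 ≤ U - L
    · -- B1: several terms, but the harmonic sum over the window is `≤ 2(U−L)/L ≤ 2θ`
      have hL1 : 1 ≤ L := by linarith
      have hsum1 : ∑ m ∈ S, (1 : ℝ) / m ≤ 2 * (U - L) / L := sum_window_inv_le hL1 hB1 S hmemS
      have hratio : 2 * (U - L) / L ≤ 2 * θ := by
        rw [div_le_iff₀ hL0]; linarith
      have hMB : M ≤ 2 * δ * θ := by
        calc M ≤ δ * ∑ m ∈ S, (1 : ℝ) / m := hMtriv
          _ ≤ δ * (2 * θ) := mul_le_mul_of_nonneg_left (hsum1.trans hratio) hδ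
          _ = 2 * δ * θ := by ring
      set Y : ℕ := max ⌊U⌋₊ 2 with hYdef
      have hY2 : 2 ≤ Y := le_max_right _ _
      have hSsub : S ⊆ Icc 1 Y := by
        intro n hn
        have h1 : 1 ≤ n := (Finset.mem_Ico.mp (Finset.mem_filter.mp hn).1).1
        have h2 : n ≤ ⌊U⌋₊ := Nat.le_floor (hmemS n hn).2.le
        rw [Finset.mem_Icc]
        exact ⟨h1, h2.trans (le_max_left _ _)⟩
      have hG' : G ≤ E * Real.log Y ^ 5 :=
        (Finset.sum_le_sum_of_subset_of_nonneg hSsub fun n _ _ => by positivity).trans (hE Y hY2 d r)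
      have hY0 : (0 : ℝ) < Y := by exact_mod_cast (by omega : 0 < Y)
      have hYle : (Y : ℝ) ≤ 2 * (D : ℝ) ^ 2 := by
        rw [hYdef, Nat.cast_max]
        refine max_le ?_ (by push_cast; linarith)
        exact (Nat.floor_le (by linarith)).trans hU2
      have hlogY : Real.log Y ≤ Real.log (2 * (D : ℝ) ^ 2) := Real.log_le_log hY0 hYle
      have hlogY0 : 0 ≤ Real.log Y := Real.log_nonneg (by exact_mod_cast (by omega : 1 ≤ Y))
      have hG'' : G ≤ E * Real.log (2 * (D : ℝ) ^ 2) ^ 5 :=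
        hG'.trans (mul_le_mul_of_nonneg_left (pow_le_pow_left₀ hlogY0 hlogY 5) hE0)
      calc M * G ≤ (2 * δ * θ) * (E * Real.log (2 * (D : ℝ) ^ 2) ^ 5) :=
            mul_le_mul hMB hG'' hG0 (by positivity)
        _ = δ * (2 * θ * (E * Real.log (2 * (D : ℝ) ^ 2) ^ 5)) := by ring
        _ ≤ (δ + Λ) * (2 * θ * (E * Real.log (2 * (D : ℝ) ^ 2) ^ 5)) :=
            mul_le_mul_of_nonneg_right hδΛ hR2
        _ ≤ (δ + Λ) * (20 * E * Real.log N ^ 5 / D +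
              2 * θ * (E * Real.log (2 * (D : ℝ) ^ 2) ^ 5) + A) := by
            refine mul_le_mul_of_nonneg_left ?_ (by positivity); linarith
    · -- B2: at most one term
      push Not at hB1
      have hcard : S.card ≤ 1 := Finset.card_le_one.mpr fun a ha b hb =>
        eq_of_mem_short_window hB1.le (hmemS a ha) (hmemS b hb)
      obtain ⟨n₀, hSn₀⟩ := Finset.card_le_one_iff_subset_singleton.mp hcard
      rcases Finset.subset_singleton_iff.mp hSn₀ with hSe | hS1
      · have hG : G = 0 := by rw [hGdef, hSe, Finset.sum_empty]
        rw [hG, mul_zero]; positivity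
      · have hn₀S : n₀ ∈ S := by rw [hS1]; exact Finset.mem_singleton_self _
        have hn₀1 : 1 ≤ n₀ := (Finset.mem_Ico.mp (Finset.mem_filter.mp hn₀S).1).1
        have hn₀0 : (0 : ℝ) < n₀ := by exact_mod_cast hn₀1
        have hM1 : M ≤ δ := by
          calc M ≤ δ * ∑ m ∈ S, (1 : ℝ) / m := hMtriv
            _ = δ * (1 / n₀) := by rw [hS1, Finset.sum_singleton]
            _ ≤ δ * 1 := by
                refine mul_le_mul_of_nonneg_left ?_ hδ
                rw [div_le_one hn₀0]; exact_mod_cast hn₀1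
            _ = δ := mul_one _
        have hGA : G ≤ A := by
          calc G = ‖xiZero c' D j n₀ d r‖ / n₀ := by rw [hGdef, hS1, Finset.sum_singleton]
            _ ≤ gC c' D n₀ / n₀ :=
                div_le_div_of_nonneg_right (norm_xiZero_le_gC c' D (by omega) j d r) hn₀0.le
            _ ≤ A * n₀ / n₀ := div_le_div_of_nonneg_right (hA n₀ hn₀1) hn₀0.le
            _ = A := by field_simp
        calc M * G ≤ δ * A := mul_le_mul hM1 hGA hG0 hδ
          _ ≤ (δ + Λ) * A := mul_le_mul_of_nonneg_right hδΛ hA0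
          _ ≤ (δ + Λ) * (20 * E * Real.log N ^ 5 / D +
                2 * θ * (E * Real.log (2 * (D : ℝ) ^ 2) ^ 5) + A) := by
              refine mul_le_mul_of_nonneg_left ?_ (by positivity); linarith

end Pieces


/-- **From a termwise bound to a bound for `S_j`.** If every `(d, r)`-term of `S_j(𝐚₁,𝐚₂)` has norm
`≤ (Λc(d)/d)·(|μ(r)|Λc(r)/(rφ(r)))·B`, then `‖S_j(𝐚₁,𝐚₂)‖ ≤ (Σ_d Λc(d)/d)(Σ_r |μ(r)|Λc(r)/(rφ(r)))·B`.
[cite: Zhang2022LandauSiegel, §7 Prop. 7.1 p.33] -/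
theorem norm_Sj_le_of_termwise (c' : ℝ) {D : ℕ} (j : ℕ) (a₁ a₂ : ℕ → ℂ) {B : ℝ}
    (h : ∀ d ∈ Ico 1 (Nsupp D), ∀ r ∈ Ico 1 (Nsupp D),
      ‖((ArithmeticFunction.moebius r).natAbs : ℂ) * lamZero c' D j (d * r) /
            ((d * r : ℕ) * (Nat.totient r : ℂ)) *
          (∑ m ∈ Ico 1 (Nsupp D), a₁ (d * r * m) / (m : ℂ) ^ (1 - betaJ c' D j)) *
          (∑ n ∈ Ico 1 (Nsupp D), a₂ (d * r * n) * xiZero c' D j n d r / (n : ℂ))‖ ≤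
        (LamC d / d * (((ArithmeticFunction.moebius r).natAbs : ℝ) * LamC r /
          ((r : ℝ) * (Nat.totient r : ℝ)))) * B) :
    ‖Sj c' D j a₁ a₂‖ ≤ (∑ d ∈ Ico 1 (Nsupp D), LamC d / d) *
      (∑ r ∈ Ico 1 (Nsupp D), ((ArithmeticFunction.moebius r).natAbs : ℝ) * LamC r /
        ((r : ℝ) * (Nat.totient r : ℝ))) * B := by
  unfold Sj
  refine (norm_sum_le _ _).trans ?_
  refine (Finset.sum_le_sum fun d _ => norm_sum_le _ _).trans ?_
  refine (Finset.sum_le_sum fun d hd => Finset.sum_le_sum fun r hr => h d hd r hr).trans ?_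
  rw [Finset.sum_mul_sum, Finset.sum_mul]
  refine le_of_eq (Finset.sum_congr rfl fun d _ => ?_)
  rw [Finset.sum_mul]

/-! ### Part 4. The theorem -/

/-- **`S_j(𝐛, 𝐛̄)` for a single-window sequence.** For every `c′` there are `K ≥ 0` and `D₀`
such that for all `D ≥ D₀`, every Dirichlet character `χ ≠ 1` mod `D`, every `j`, every window
centre `X > 0` with `Xη₊ ≤ ⌈PT⁻²⌉`, and every `w : ℕ → ℂ` supported on the integers of
`(Xη₋, Xη₊)` (`η_± = e^{±𝓛⁻¹⁰}`) with `|w| ≤ δ` and `|w(n') − w(n)| ≤ Λ log(n'/n)` there: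
`‖S_j(χ·w, conj(χ·w))‖ ≤ K · δ(δ + Λ) · 𝓛⁹`. (For the §11 window coefficients
`δ, Λ = O(𝓛⁻¹⁰)`, so `𝓛⁹‖S_j‖ = O(𝓛⁻²) → 0`: the input the per-window mean-square reduction of
`Z22:§11.u019` consumes.) Route: `‖S_j‖ ≤ ΣΣ (Λc(d)/d)(|μ(r)|Λc(r)/(rφ(r)))·‖M(dr)‖·‖N(d,r)‖`,
`msum_mul_nsum_le` per `(d, r)`, and the tree's `sum_LamC_div_le` (`≪ log N ≤ 2𝓛⁹`),
`sum_moebius_LamC_div_le` (`≪ 1`). [cite: Zhang2022LandauSiegel, §7 Prop. 7.1 p.33; §11 p.64] -/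
theorem norm_Sj_window_le (c' : ℝ) : ∃ K : ℝ, 0 ≤ K ∧ ∃ D₀ : ℕ,
    ∀ (D : ℕ) [NeZero D] (χ : DirichletCharacter ℂ D), D₀ ≤ D → χ ≠ 1 →
    ∀ (j : ℕ) (X δ Λ : ℝ) (w : ℕ → ℂ), 0 < X → X * etaPM D 1 ≤ (Nsupp D : ℝ) → 0 ≤ δ → 0 ≤ Λ →
      (∀ n : ℕ, ¬(X * etaPM D (-1) < n ∧ (n : ℝ) < X * etaPM D 1) → w n = 0) →
      (∀ n, ‖w n‖ ≤ δ) →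
      (∀ n n' : ℕ, X * etaPM D (-1) < n → n ≤ n' → (n' : ℝ) < X * etaPM D 1 →
        ‖w n' - w n‖ ≤ Λ * Real.log ((n' : ℝ) / n)) →
      ‖Sj c' D j (fun n => χ (n : ZMod D) * w n) (fun n => conj (χ (n : ZMod D) * w n))‖ ≤
        K * δ * (δ + Λ) * ell D ^ 9 := by
  classical
  obtain ⟨E, hE0, hE⟩ := exists_sum_norm_xiZero_div_le
  obtain ⟨A, hA0, hA⟩ := exists_gC_le_linear
  obtain ⟨E₂, hE₂⟩ : ∃ E₂ : ℝ,
      E₂ = Real.exp (4 * ((1 : ℕ) : ℝ) + 12 + 7 * LogEulerProduct.tailConst 0) := ⟨_, rfl⟩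
  obtain ⟨E₄, hE₄⟩ : ∃ E₄ : ℝ, E₄ = Real.exp (14 + 7 * LogEulerProduct.tailConst 0) := ⟨_, rfl⟩
  obtain ⟨C₄₅, hC₄₅0, hC₄₅⟩ : ∃ C : ℝ, 0 ≤ C ∧ ∀ x : ℝ, 1 ≤ x → Real.log x ^ 45 ≤ C * x :=
    ⟨(45 : ℝ) ^ 45, by positivity, fun x hx => by exact_mod_cast pow_log_le hx (n := 45) (by norm_num)⟩
  obtain ⟨R₀, hR₀⟩ : ∃ R₀ : ℝ, R₀ = 20 * E * (32 * C₄₅) + 2 * E * (4 * 3 ^ 5) + A :=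
    ⟨_, rfl⟩
  have hE₂0 : 0 < E₂ := by rw [hE₂]; exact Real.exp_pos _
  have hE₄0 : 0 < E₄ := by rw [hE₄]; exact Real.exp_pos _
  have hR₀0 : 0 ≤ R₀ := by rw [hR₀]; positivity
  refine ⟨R₀ * (E₂ * 2) * E₄, by positivity, ⌈Real.exp (5 * |c'| * Real.pi + 3)⌉₊, ?_⟩
  intro D _ χ hD hχ j X δ Λ w hX hXN hδ hΛ hw0 hwδ hwΛ
  -- sizes in `D`
  obtain ⟨hL3, hBs⟩ := three_le_ell_and_Bsum_le hD
  set ℓ := ell D with hℓ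
  have hℓ1 : 1 ≤ ℓ := by linarith
  have hℓ0 : 0 < ℓ := by linarith
  have hB1 : Bsum c' D ≤ 1 := by
    refine hBs.trans ?_
    rw [div_le_one (by positivity)]
    calc 9 * Real.pi ≤ 9 * 4 := by linarith [Real.pi_le_four]
      _ ≤ (3 : ℝ) ^ 9 := by norm_num
      _ ≤ ℓ ^ 9 := pow_le_pow_left₀ (by norm_num) hL3 9
  have hD2 : 2 ≤ D := by
    by_contra h
    push Not at h
    have h1 : (D : ℝ) ≤ 1 := by exact_mod_cast (by omega : D ≤ 1)
    have : ℓ ≤ 0 := by rw [hℓ, ell]; exact Real.log_nonpos (Nat.cast_nonneg D) h1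
    linarith
  have hD0 : (0 : ℝ) < D := by exact_mod_cast (by omega : 0 < D)
  have hD1 : (1 : ℝ) ≤ D := by exact_mod_cast (by omega : 1 ≤ D)
  have hD2r : (2 : ℝ) ≤ D := by exact_mod_cast hD2
  -- `N = ⌈PT⁻²⌉ ≥ 2`, `log N ≤ 2𝓛⁹`
  set N : ℕ := Nsupp D with hNdef
  have hPT : bigP D / bigT D ^ 2 = Real.exp (ℓ ^ 9 - 2 * ℓ ^ (1.1 : ℝ)) := by
    rw [bigP, bigT, ← Real.exp_nat_mul, ← Real.exp_sub]
    push_cast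
    rfl
  have hl11 : ℓ ^ (1.1 : ℝ) ≤ ℓ ^ 2 := by
    calc ℓ ^ (1.1 : ℝ) ≤ ℓ ^ (2 : ℝ) := Real.rpow_le_rpow_of_exponent_le hℓ1 (by norm_num)
      _ = ℓ ^ 2 := Real.rpow_two ℓ
  have hl9 : 2 * ℓ ^ 2 + 1 ≤ ℓ ^ 9 := by
    have h7 : (2187 : ℝ) ≤ ℓ ^ 7 := by
      calc (2187 : ℝ) = 3 ^ 7 := by norm_num
        _ ≤ ℓ ^ 7 := pow_le_pow_left₀ (by norm_num) hL3 7
    have hl2 : 1 ≤ ℓ ^ 2 := one_le_pow₀ hℓ1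
    nlinarith
  have hN2r : (2 : ℝ) ≤ N := by
    have h1 : Real.exp 1 ≤ bigP D / bigT D ^ 2 := by
      rw [hPT]; exact Real.exp_le_exp.mpr (by linarith)
    have h2 : (2 : ℝ) ≤ Real.exp 1 := by
      have := Real.add_one_le_exp (1 : ℝ); linarith
    calc (2 : ℝ) ≤ bigP D / bigT D ^ 2 := h2.trans h1
      _ ≤ N := by rw [hNdef, Nsupp]; exact Nat.le_ceil _
  have hN2 : 2 ≤ N := by exact_mod_cast hN2r
  have hNpos : (0 : ℝ) < N := by linarith
  have hP1 : 1 ≤ bigP D := by rw [bigP]; exact Real.one_le_exp (by positivity)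
  have hT1 : 1 ≤ bigT D := by rw [bigT]; exact Real.one_le_exp (by positivity)
  have hNle : (N : ℝ) ≤ 2 * bigP D := by
    have h1 : (N : ℝ) < bigP D / bigT D ^ 2 + 1 := by
      rw [hNdef, Nsupp]; exact Nat.ceil_lt_add_one (by positivity)
    have h2 : bigP D / bigT D ^ 2 ≤ bigP D := div_le_self (by linarith) (one_le_pow₀ hT1)
    linarith
  have hlogN : Real.log N ≤ 2 * ℓ ^ 9 := by
    calc Real.log N ≤ Real.log (2 * bigP D) := Real.log_le_log hNpos hNle
      _ = Real.log 2 + ℓ ^ 9 := by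
          rw [Real.log_mul (by norm_num) (by linarith), bigP, Real.log_exp]
      _ ≤ 1 + ℓ ^ 9 := by
          have := Real.log_le_sub_one_of_pos (show (0 : ℝ) < 2 by norm_num); linarith
      _ ≤ 2 * ℓ ^ 9 := by linarith [one_le_pow₀ (n := 9) hℓ1]
  have hlogN0 : 0 ≤ Real.log N := Real.log_nonneg (by linarith)
  -- the relative window width `η₊/η₋ − 1 ≤ 4𝓛⁻¹⁰ ≤ 1`
  have hl10 : (4 : ℝ) ≤ ℓ ^ 10 := le_trans (by norm_num) (pow_le_pow_left₀ (by norm_num) hL3 10)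
  have hθ1 : 4 * (ℓ ^ 10)⁻¹ ≤ 1 := by
    rw [mul_inv_le_iff₀ (by positivity), one_mul]; exact hl10
  have hθ : etaPM D 1 / etaPM D (-1) - 1 ≤ 4 * (ℓ ^ 10)⁻¹ := by
    have hx0 : (0 : ℝ) ≤ 2 * (ℓ ^ 10)⁻¹ := by positivity
    have hx : |2 * (ℓ ^ 10)⁻¹| ≤ 1 := by rw [abs_of_nonneg hx0]; linarith
    have e : etaPM D 1 / etaPM D (-1) = Real.exp (2 * (ℓ ^ 10)⁻¹) := by
      rw [etaPM, etaPM, ← Real.exp_sub]; congr 1; rw [hℓ]; ring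
    rw [e]
    have h := Real.abs_exp_sub_one_le hx
    rw [abs_of_nonneg hx0] at h
    linarith [le_abs_self (Real.exp (2 * (ℓ ^ 10)⁻¹) - 1)]
  -- the per-`(d,r)` constant and its absolute bound
  obtain ⟨R, hRdef⟩ : ∃ R : ℝ, R = 20 * E * Real.log N ^ 5 / D +
    2 * (4 * (ℓ ^ 10)⁻¹) * (E * Real.log (2 * (D : ℝ) ^ 2) ^ 5) + A := ⟨_, rfl⟩
  have hRR₀ : R ≤ R₀ := by
    have h1 : Real.log N ^ 5 / D ≤ 32 * C₄₅ := by
      have hl45 : ℓ ^ 45 ≤ C₄₅ * D := by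
        have := hC₄₅ (D : ℝ) hD1
        rw [hℓ, ell]; exact this
      rw [div_le_iff₀ hD0]
      calc Real.log N ^ 5 ≤ (2 * ℓ ^ 9) ^ 5 := pow_le_pow_left₀ hlogN0 hlogN 5
        _ = 32 * ℓ ^ 45 := by ring
        _ ≤ 32 * (C₄₅ * D) := by linarith
        _ = 32 * C₄₅ * D := by ring
    have h2 : (4 * (ℓ ^ 10)⁻¹) * Real.log (2 * (D : ℝ) ^ 2) ^ 5 ≤ 4 * 3 ^ 5 := by
      have hlog2 : Real.log (2 * (D : ℝ) ^ 2) ≤ 3 * ℓ := by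
        have h3 : 2 * (D : ℝ) ^ 2 ≤ (D : ℝ) ^ 3 := by
          calc 2 * (D : ℝ) ^ 2 ≤ (D : ℝ) * (D : ℝ) ^ 2 :=
                mul_le_mul_of_nonneg_right hD2r (by positivity)
            _ = (D : ℝ) ^ 3 := by ring
        calc Real.log (2 * (D : ℝ) ^ 2) ≤ Real.log ((D : ℝ) ^ 3) :=
              Real.log_le_log (by positivity) h3
          _ = 3 * ℓ := by rw [Real.log_pow, hℓ, ell]; push_cast; ring
      have hlog0 : 0 ≤ Real.log (2 * (D : ℝ) ^ 2) := by
        refine Real.log_nonneg ?_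
        have := pow_le_pow_left₀ (by norm_num : (0 : ℝ) ≤ 2) hD2r 2
        norm_num at this
        linarith
      have hpow : Real.log (2 * (D : ℝ) ^ 2) ^ 5 ≤ (3 * ℓ) ^ 5 := pow_le_pow_left₀ hlog0 hlog2 5
      have hl5 : ℓ ^ 5 ≤ ℓ ^ 10 := pow_le_pow_right₀ hℓ1 (by norm_num)
      have hl10pos : 0 < ℓ ^ 10 := by positivity
      calc (4 * (ℓ ^ 10)⁻¹) * Real.log (2 * (D : ℝ) ^ 2) ^ 5 ≤ (4 * (ℓ ^ 10)⁻¹) * (3 * ℓ) ^ 5 :=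
            mul_le_mul_of_nonneg_left hpow (by positivity)
        _ = 4 * 3 ^ 5 * (ℓ ^ 5 * (ℓ ^ 10)⁻¹) := by ring
        _ ≤ 4 * 3 ^ 5 * 1 := by
            refine mul_le_mul_of_nonneg_left ?_ (by norm_num)
            rw [mul_inv_le_iff₀ hl10pos, one_mul]; exact hl5
        _ = 4 * 3 ^ 5 := mul_one _
    calc R = 20 * E * (Real.log N ^ 5 / D) +
          2 * E * ((4 * (ℓ ^ 10)⁻¹) * Real.log (2 * (D : ℝ) ^ 2) ^ 5) + A := by rw [hRdef]; ring
      _ ≤ 20 * E * (32 * C₄₅) + 2 * E * (4 * 3 ^ 5) + A := by gcongr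
      _ = R₀ := by rw [hR₀]
  have hD4 : (4 : ℝ) ≤ (D : ℝ) ^ 2 := by
    have := pow_le_pow_left₀ (by norm_num : (0 : ℝ) ≤ 2) hD2r 2
    norm_num at this
    exact this
  have hR0 : 0 ≤ R := by
    have : 0 ≤ Real.log (2 * (D : ℝ) ^ 2) := Real.log_nonneg (by linarith)
    rw [hRdef]; positivity
  -- the weight sums
  have hsumU : ∑ d ∈ Ico 1 N, LamC d / d ≤ E₂ * (2 * ℓ ^ 9) := by
    calc ∑ d ∈ Ico 1 N, LamC d / d ≤ ∑ d ∈ Icc 1 N, LamC d / d :=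
          Finset.sum_le_sum_of_subset_of_nonneg
            (fun d hd => by rw [Finset.mem_Ico] at hd; rw [Finset.mem_Icc]; omega)
            fun d _ _ => div_nonneg (LamC_nonneg d) (Nat.cast_nonneg d)
      _ ≤ Real.exp (4 * (1 : ℕ) + 0 * Real.log (4 * N) + 12 + 7 * LogEulerProduct.tailConst 0) *
            Real.log N ^ (1 : ℕ) := sum_LamC_div_le hN2
      _ = E₂ * Real.log N := by rw [hE₂]; simp
      _ ≤ E₂ * (2 * ℓ ^ 9) := mul_le_mul_of_nonneg_left hlogN hE₂0.le
  have hsumV : ∑ r ∈ Ico 1 N, ((ArithmeticFunction.moebius r).natAbs : ℝ) * LamC r /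
      ((r : ℝ) * (Nat.totient r : ℝ)) ≤ E₄ := by
    calc ∑ r ∈ Ico 1 N, ((ArithmeticFunction.moebius r).natAbs : ℝ) * LamC r /
          ((r : ℝ) * (Nat.totient r : ℝ))
        ≤ ∑ r ∈ Icc 1 N, ((ArithmeticFunction.moebius r).natAbs : ℝ) * LamC r /
            ((r : ℝ) * (Nat.totient r : ℝ)) :=
          Finset.sum_le_sum_of_subset_of_nonneg
            (fun r hr => by rw [Finset.mem_Ico] at hr; rw [Finset.mem_Icc]; omega)
            fun r _ _ => by
              exact div_nonneg (mul_nonneg (Nat.cast_nonneg _) (LamC_nonneg r)) (by positivity)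
      _ ≤ E₄ := by rw [hE₄]; exact sum_moebius_LamC_div_le N
  have hU0 : 0 ≤ ∑ d ∈ Ico 1 N, LamC d / d :=
    Finset.sum_nonneg fun d _ => div_nonneg (LamC_nonneg d) (Nat.cast_nonneg d)
  have hV0 : 0 ≤ ∑ r ∈ Ico 1 N, ((ArithmeticFunction.moebius r).natAbs : ℝ) * LamC r /
      ((r : ℝ) * (Nat.totient r : ℝ)) :=
    Finset.sum_nonneg fun r _ =>
      div_nonneg (mul_nonneg (Nat.cast_nonneg _) (LamC_nonneg r)) (by positivity)
  have hu0 : ∀ d : ℕ, 0 ≤ LamC d / d := fun d => div_nonneg (LamC_nonneg d) (Nat.cast_nonneg d)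
  have hv0 : ∀ r : ℕ, 0 ≤ ((ArithmeticFunction.moebius r).natAbs : ℝ) * LamC r /
      ((r : ℝ) * (Nat.totient r : ℝ)) := fun r =>
    div_nonneg (mul_nonneg (Nat.cast_nonneg _) (LamC_nonneg r)) (by positivity)
  -- the termwise bound
  have hterm : ∀ d ∈ Ico 1 N, ∀ r ∈ Ico 1 N,
      ‖((ArithmeticFunction.moebius r).natAbs : ℂ) * lamZero c' D j (d * r) /
            ((d * r : ℕ) * (Nat.totient r : ℂ)) *
          (∑ m ∈ Ico 1 N, χ ((d * r * m : ℕ) : ZMod D) * w (d * r * m) /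
            (m : ℂ) ^ (1 - betaJ c' D j)) *
          (∑ n ∈ Ico 1 N, conj (χ ((d * r * n : ℕ) : ZMod D) * w (d * r * n)) *
            xiZero c' D j n d r / (n : ℂ))‖ ≤
        (LamC d / d * (((ArithmeticFunction.moebius r).natAbs : ℝ) * LamC r /
          ((r : ℝ) * (Nat.totient r : ℝ)))) * (δ * ((δ + Λ) * R)) := by
    intro d hd r hr
    have hd1 : 1 ≤ d := (Finset.mem_Ico.mp hd).1
    have hr1 : 1 ≤ r := (Finset.mem_Ico.mp hr).1
    have hwt := norm_weight_le c' (D := D) (d := d) (r := r) (by omega) (by omega) j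
    have hNs := norm_nsum_le c' χ w hw0 hwδ j d r N (d * r)
    have hMN := msum_mul_nsum_le c' χ hχ j hB1 hD2 hN2 hX hδ hΛ hXN hθ hθ1 hE0
      (fun Y hY d' r' => hE c' D Y hY j d' r') hA0 (fun n hn => hA c' D n hn) w hw0 hwδ hwΛ
      hd1 hr1
    rw [← hRdef] at hMN
    rw [norm_mul, norm_mul, mul_assoc]
    refine mul_le_mul hwt ?_ (by positivity) (mul_nonneg (hu0 d) (hv0 r))
    calc ‖∑ m ∈ Ico 1 N, χ ((d * r * m : ℕ) : ZMod D) * w (d * r * m) /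
            (m : ℂ) ^ (1 - betaJ c' D j)‖ *
          ‖∑ n ∈ Ico 1 N, conj (χ ((d * r * n : ℕ) : ZMod D) * w (d * r * n)) *
            xiZero c' D j n d r / (n : ℂ)‖
        ≤ ‖∑ m ∈ Ico 1 N, χ ((d * r * m : ℕ) : ZMod D) * w (d * r * m) /
            (m : ℂ) ^ (1 - betaJ c' D j)‖ *
          (δ * ∑ n ∈ (Ico 1 N).filter (fun n : ℕ => X * etaPM D (-1) < ((d * r * n : ℕ) : ℝ) ∧
            ((d * r * n : ℕ) : ℝ) < X * etaPM D 1), ‖xiZero c' D j n d r‖ / n) :=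
          mul_le_mul_of_nonneg_left hNs (norm_nonneg _)
      _ = δ * (‖∑ m ∈ Ico 1 N, χ ((d * r * m : ℕ) : ZMod D) * w (d * r * m) /
            (m : ℂ) ^ (1 - betaJ c' D j)‖ *
          ∑ n ∈ (Ico 1 N).filter (fun n : ℕ => X * etaPM D (-1) < ((d * r * n : ℕ) : ℝ) ∧
            ((d * r * n : ℕ) : ℝ) < X * etaPM D 1), ‖xiZero c' D j n d r‖ / n) := by ring
      _ ≤ δ * ((δ + Λ) * R) := mul_le_mul_of_nonneg_left hMN hδ
  -- assembling
  refine (norm_Sj_le_of_termwise c' j _ _ (B := δ * ((δ + Λ) * R)) fun d hd r hr => ?_).trans ?_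
  · exact hterm d hd r hr
  · have h1 : (∑ d ∈ Ico 1 N, LamC d / d) *
        (∑ r ∈ Ico 1 N, ((ArithmeticFunction.moebius r).natAbs : ℝ) * LamC r /
          ((r : ℝ) * (Nat.totient r : ℝ))) ≤ (E₂ * (2 * ℓ ^ 9)) * E₄ :=
      mul_le_mul hsumU hsumV hV0 (by positivity)
    have h2 : δ * ((δ + Λ) * R) ≤ δ * ((δ + Λ) * R₀) :=
      mul_le_mul_of_nonneg_left (mul_le_mul_of_nonneg_left hRR₀ (by positivity)) hδ
    calc (∑ d ∈ Ico 1 N, LamC d / d) *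
          (∑ r ∈ Ico 1 N, ((ArithmeticFunction.moebius r).natAbs : ℝ) * LamC r /
            ((r : ℝ) * (Nat.totient r : ℝ))) * (δ * ((δ + Λ) * R))
        ≤ (E₂ * (2 * ℓ ^ 9)) * E₄ * (δ * ((δ + Λ) * R₀)) :=
          mul_le_mul h1 h2 (mul_nonneg hδ (mul_nonneg (by positivity) hR0)) (by positivity)
      _ = R₀ * (E₂ * 2) * E₄ * δ * (δ + Λ) * ℓ ^ 9 := by ring

end Literature.NumberTheory.LFunctions.Zhang2022.SjWindow
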